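import Summits.QuantumFields.YangMills.Theorems.BalabanUVNodesN18AvgRemainderCoarseDiff
import Summits.QuantumFields.YangMills.Theorems.BalabanUVNodesN18CondIKRow
import Summits.QuantumFields.YangMills.Theorems.UnitScaleTiltProp7IterLinearisationFlat
import Literature.MathematicalPhysics.QuantumFieldTheory.Balaban1983to89.BlockAveragingFederbush

/-!
# BalabanUVNodes ∕ node N18 = NE5 — closure-ledger item (iii), (β3b) first file: [Balaban1985Averaging] PROP. 3 (121)–(123) AT THE FLAT BACKGROUND IN
# PRINT'S LOGARITHMIC CHART `Q(V₀, A, c) = (1∕i)·log(V̄₁)_c` FOR THE (0.4) AVERAGE OF RECORD — C⁰ AND C¹: the potential remainder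
# `P_c(U) := log Ū(c) − (Q₁Y)(c)` is second order (`≤ 151(ℓδ)²`), LIPSCHITZ WITH THE SMALLNESS FACTOR (`≤ 290·ℓ²δ·ε`) and its COARSE DIFFERENCES are second
# order (`≤ 290·ℓ²δ·η`); hence the SUP and COARSE-DIFFERENCE letters of the comb-corrected averaged potential `log Ū(c) + (λ̄_Y(c₊) − λ̄_Y(c₋)) = L·(QY)(c) + P_c(U)`
# from King's K-row (Track A, DAG node N18 = `T4OutputRate.NE5` :211; cluster K4 «SpineRates», item K3⁷ `SpineGivenEndpointR13SepCoPH`; WIDTH SEAT pub-ymgap-dag-n18-w3 g2,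
# successor piece «(β3b)» of seat pub-ymgap-dag-n18-d's `N18-BETA-SPEC.md`)

HONEST FRAMING.  Count-neutral kernel bookkeeping (`--supports stmt-QuantumFields-20544 --as helper`); elementary, PROVED by assembling landed bricks with the
triangle inequality: the C⁰ Prop. 3 of `BlockAveragingEMLLinearised` (`‖Ū(c) − 1 − Q₁Y‖ ≤ 81(ℓδ)²`), dag-n18-d's C¹ twins (module 25 `norm_avgRem_sub_avgRem_le`,
module 26 `avgRem_translate` ∕ `norm_translate_nsmul_sub_le`), the Federbush mean-value defect of the series logarithm (`FederbushMean.norm_mlog_sub_mlog_sub_le`,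
`norm_mlog_sub_sub_one_le_of_le`), the identification of the main term (`linAvg_eq_bondAvg_sub_grad_combMean`: `Q₁Y = L·QY − dλ̄_Y`) and King's K-row for the
straight block average `Q = LatticeFieldCalculus.bondAvg` (dag-n18-d module 19a).  NE5 is NOT PRINTED and NOT proved; N18 is NOT discharged; the transport clause
`hT₀`∕`hTsp` of N18's reading is NOT discharged here.

WHY.  The (1.12) half of N18's transport clause ([Balaban1987RG1] (1.12) p.262: «`U^u = exp iξA`, `|A|, |∇^ξA| < O(1)LMBα₀` on the cubes») reads the averaged
field through the POTENTIAL `Ā(c) = (iξ′)⁻¹ log Ū(c)` — print's own chart for Prop. 3, (121) «`Q(V₀, A, c) = (1∕i) log(V̿₁)_c`».  The tree's Prop. 3 and its C¹ twins are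
written in the exp-free chart `Ū(c) − 1`; this file moves them to `log Ū(c)` (one more second-order term, the defect `log W − (W − 1)`, bounded AND Lipschitz with
a constant of order `ℓδ` by the Federbush mean-value inequality), in the SINGLE-BAR edition: the comb term of `Q₁Y = L·QY − (λ̄_Y(c₊) − λ̄_Y(c₋))` is DISPLAYED
(moved to the left side as the linearised coarse gauge), not removed by print's coarse gauge `v = exp λ̄` of (62)–(63)∕(93) — that nonlinear factorisation is
(β3) proper of the spec and stays the successor's (the tree has its C⁰ one-step form for the unguarded complexified average: `Prop8Chart.norm_conj_emlAvgU_sub_one_le`).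
With the comb term on the left, the SUP letter of the corrected potential is `L × (K-a)` and its COARSE-DIFFERENCE letter is `L × (K-b)` up to `290·ℓ²·L·δ·δ₁` —
«`δ ×` the field's own unit differences», i.e. the relative slack `O(d²L·ξ_B·α₀)` of the spec's (β2)–(β5), summable in the scale.

WHAT (all at the tree's objects: `Ū = avgFun expMeanLogSU U` on `SU(N)`, `Y_b = U_b − 1`, `Q₁ = linAvg`, `λ̄ = combMean`, `Q = bondAvg`, `log = MatrixLog.mlog`; `ℓ = (d+2)L`;
smallness regime of module 25: `‖Y_b‖ ≤ δ`, `24ℓδ ≤ 1`, `2ℓδ < δ_N`).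
* §1 `norm_avgFun_sub_one_le` (`‖Ū(c) − 1‖ ≤ 3ℓδ + 81(ℓδ)² ≤ 7ℓδ`), `norm_mlog_avgFun_sub_sub_one_le` (the log defect `≤ 70(ℓδ)²`),
  ★ `norm_mlog_avgFun_sub_linAvg_le` (C⁰: `‖log Ū(c) − (Q₁Y)(c)‖ ≤ 151(ℓδ)²` — print's (123) `|C(V₀, A, c)| ≤ C₁L²|A|²` at `V₀ = 1`, single bar).
* §2 `norm_avgFun_sub_avgFun_le` (`‖Ū(c) − Ū′(c)‖ ≤ (3 + 181ℓδ)·ℓε`, any `SU(N)`), ★ `norm_potRem_sub_potRem_le` (C¹: `‖P_c(U) − P_c(U′)‖ ≤ 290·ℓ²·δ·ε`).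
* §3 `mlog_avgFun_translate`, `potRem_translate` (translation covariance), ★ `norm_potRem_translate_sub_le` (`‖P_{c+a}(U) − P_c(U)‖ ≤ 290·ℓ²·δ·η`),
  `norm_potRem_shift_sub_le` (`a = e_ν`: `η = L·δ₁`, `δ₁` = the unit `ν`-differences of `U`).
* §4 ★ `mlog_avgFun_add_grad_combMean_eq` (`log Ū(c) + (λ̄_Y(c₊) − λ̄_Y(c₋)) = L·(QY)(c) + P_c(U)`), ★ `norm_mlog_avgFun_add_grad_combMean_le` (SUP letter from the
  `L^{d+1}` feeding bonds, (K-a)), ★ `norm_shift_sub_mlog_avgFun_add_grad_combMean_le` (COARSE-DIFFERENCE letter: `L²·δ₁′ + 290·ℓ²·L·δ·δ₁`, (K-b) + §3).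

WHAT THIS IS NOT.  Not the comb-gauge-fixed (double-bar) edition; not the chart-in `U = exp(iξA)` reading (module 27 supplies its Lipschitz brick; a named twin on
request); not the `Sect2.CondI` packaging on the cubes of record; not (T1)∕(T2)∕(T3) of module 21; finite tori at fixed `ε` — not continuum ∕ OS ∕ mass gap ∕ Clay.
0 `def`, 0 `sorry`, standard axioms.

v1.0.1 (docstring-only re-cite, same seat∕generation; every declaration byte-identical below its docstring): the `[King1986, Lemma 4.5 (4.38) p.674]` locator
inherited from dag-n18-d 19a on the two K-row letters of §4 is DROPPED (ref-N READ-22 row 61 ∕ READ-24 NIT-CITE: (4.38) is King's propagator-convergence bound, not the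
block-average K-row `‖Q‖_{∞→∞} ≤ 1`, `∇Q = Q̃∇`); the K-row is cited BY NAME (dag-n18-d 19a `norm_bondAvg_le_of_forall_run` ∕ `norm_bondAvg_shift_sub_le_of_forall_run`).
-/

open scoped BigOperators

namespace YMDAG.N18.AvgPotential

open Literature.MathematicalPhysics.QuantumFieldTheory.Balaban1983to89
open Literature.MathematicalPhysics.QuantumFieldTheory.Balaban1983to89.T4Continuum
open Literature.MathematicalPhysics.QuantumFieldTheory.Balaban1983to89.BlockAveraging
open Literature.MathematicalPhysics.QuantumFieldTheory.Balaban1983to89.LatticeFieldCalculus (bondAvg runBond runSite)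
open Literature.MathematicalPhysics.QuantumFieldTheory.Balaban1983to89.ExpMeanLog (deltaSU expMeanLogSU)
open Literature.MathematicalPhysics.QuantumFieldTheory.Balaban1983to89.MatrixLog (mlog)
open Literature.MathematicalPhysics.QuantumFieldTheory.Balaban1983to89.FederbushMean (norm_mlog_sub_mlog_sub_le norm_mlog_sub_sub_one_le_of_le)
open Literature.MathematicalPhysics.QuantumFieldTheory.Balaban1983to89.BlockAveragingEMLLinearised (walkSum linAvg combMean
  norm_avgFun_sub_one_sub_linAvg_le linAvg_eq_bondAvg_sub_grad_combMean)
open YMDAG.N18.HolonomyLipschitz (norm_avgRem_sub_avgRem_le avgFun_translate_apply norm_translate_nsmul_sub_le)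
open YMDAG.N18.CondIKRow (norm_bondAvg_le_of_forall_run norm_bondAvg_shift_sub_le_of_forall_run)
open Summit.QuantumFields.YangMills.Theorems.Prop7AvgLinearisation (linAvg_sub norm_linAvg_le)

open scoped Matrix.Norms.L2Operator

variable {n : Type*} [Fintype n] [DecidableEq n] [Nonempty n] {P : Params} {j : ℕ}

/-! ## §1 The averaged field and its logarithm to second order (C⁰) -/

section CZero

/-- **`‖Ū(c) − 1‖ ≤ 3ℓδ + 81(ℓδ)²`**: the averaged configuration is within first order of `1` — the linear term `‖(Q₁Y)(c)‖ ≤ 3ℓδ` (two staircases and a segment,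
`Prop7AvgLinearisation.norm_linAvg_le`) plus the C⁰ remainder of `BlockAveragingEMLLinearised`. [cite: Balaban1985Averaging, Prop. 3 (122)-(125) p.36] -/
theorem norm_avgFun_sub_one_le (U : GaugeField P j (Matrix.specialUnitaryGroup n ℂ)) {δ : ℝ} (hδ : 0 ≤ δ)
    (hU : ∀ b, ‖((U b : Matrix.specialUnitaryGroup n ℂ) : Matrix n n ℂ) - 1‖ ≤ δ)
    (h24 : 24 * ((((P.d + 2) * P.L : ℕ) : ℝ) * δ) ≤ 1) (hN : 2 * ((((P.d + 2) * P.L : ℕ) : ℝ) * δ) < deltaSU n) (c : PBond P (j + 1)) :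
    ‖((avgFun (expMeanLogSU (n := n)) U c : Matrix.specialUnitaryGroup n ℂ) : Matrix n n ℂ) - 1‖ ≤
      3 * ((((P.d + 2) * P.L : ℕ) : ℝ) * δ) + 81 * ((((P.d + 2) * P.L : ℕ) : ℝ) * δ) ^ 2 := by
  have h16 : 16 * ((((P.d + 2) * P.L : ℕ) : ℝ) * δ) ≤ 1 := by linarith
  have hR := norm_avgFun_sub_one_sub_linAvg_le U hδ hU h16 hN c
  have hQ := norm_linAvg_le (fun b => ((U b : Matrix.specialUnitaryGroup n ℂ) : Matrix n n ℂ) - 1) hδ hU c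
  have e : ((avgFun (expMeanLogSU (n := n)) U c : Matrix.specialUnitaryGroup n ℂ) : Matrix n n ℂ) - 1 =
      (((avgFun (expMeanLogSU (n := n)) U c : Matrix.specialUnitaryGroup n ℂ) : Matrix n n ℂ) - 1 -
          linAvg (fun b => ((U b : Matrix.specialUnitaryGroup n ℂ) : Matrix n n ℂ) - 1) c) +
        linAvg (fun b => ((U b : Matrix.specialUnitaryGroup n ℂ) : Matrix n n ℂ) - 1) c := by abel
  rw [e]
  calc _ ≤ _ := norm_add_le _ _
    _ ≤ 81 * ((((P.d + 2) * P.L : ℕ) : ℝ) * δ) ^ 2 + 3 * (((P.d + 2) * P.L : ℕ) : ℝ) * δ := add_le_add hR hQ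
    _ = _ := by ring

/-- `‖Ū(c) − 1‖ ≤ 7ℓδ` under `24ℓδ ≤ 1` (`81(ℓδ)² ≤ (81∕24)·ℓδ`). [cite: Balaban1985Averaging, Prop. 3 (122)-(125) p.36] -/
theorem norm_avgFun_sub_one_le_lin (U : GaugeField P j (Matrix.specialUnitaryGroup n ℂ)) {δ : ℝ} (hδ : 0 ≤ δ)
    (hU : ∀ b, ‖((U b : Matrix.specialUnitaryGroup n ℂ) : Matrix n n ℂ) - 1‖ ≤ δ)
    (h24 : 24 * ((((P.d + 2) * P.L : ℕ) : ℝ) * δ) ≤ 1) (hN : 2 * ((((P.d + 2) * P.L : ℕ) : ℝ) * δ) < deltaSU n) (c : PBond P (j + 1)) :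
    ‖((avgFun (expMeanLogSU (n := n)) U c : Matrix.specialUnitaryGroup n ℂ) : Matrix n n ℂ) - 1‖ ≤ 7 * ((((P.d + 2) * P.L : ℕ) : ℝ) * δ) := by
  have h := norm_avgFun_sub_one_le U hδ hU h24 hN c
  set σ : ℝ := (((P.d + 2) * P.L : ℕ) : ℝ) * δ
  have hσ0 : 0 ≤ σ := mul_nonneg (Nat.cast_nonneg _) hδ
  nlinarith

/-- **THE LOG DEFECT IS SECOND ORDER**: `‖log Ū(c) − (Ū(c) − 1)‖ ≤ 70(ℓδ)²` (`s²∕(1 − s)` at `s = 7ℓδ ≤ 7∕24`, `FederbushMean.norm_mlog_sub_sub_one_le_of_le`).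
[cite: Balaban1985Averaging, Prop. 3 (121)-(123) p.36] -/
theorem norm_mlog_avgFun_sub_sub_one_le (U : GaugeField P j (Matrix.specialUnitaryGroup n ℂ)) {δ : ℝ} (hδ : 0 ≤ δ)
    (hU : ∀ b, ‖((U b : Matrix.specialUnitaryGroup n ℂ) : Matrix n n ℂ) - 1‖ ≤ δ)
    (h24 : 24 * ((((P.d + 2) * P.L : ℕ) : ℝ) * δ) ≤ 1) (hN : 2 * ((((P.d + 2) * P.L : ℕ) : ℝ) * δ) < deltaSU n) (c : PBond P (j + 1)) :
    ‖mlog (((avgFun (expMeanLogSU (n := n)) U c : Matrix.specialUnitaryGroup n ℂ) : Matrix n n ℂ)) -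
        ((((avgFun (expMeanLogSU (n := n)) U c : Matrix.specialUnitaryGroup n ℂ) : Matrix n n ℂ)) - 1)‖ ≤
      70 * ((((P.d + 2) * P.L : ℕ) : ℝ) * δ) ^ 2 := by
  set σ : ℝ := (((P.d + 2) * P.L : ℕ) : ℝ) * δ with hσ
  have hσ0 : 0 ≤ σ := mul_nonneg (Nat.cast_nonneg _) hδ
  have hW := norm_avgFun_sub_one_le_lin U hδ hU h24 hN c
  have hs : 7 * σ < 1 := by linarith
  have h := norm_mlog_sub_sub_one_le_of_le hW hs
  refine h.trans ?_
  have hden : 0 < 1 - 7 * σ := by linarith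
  rw [div_mul_eq_mul_div, div_le_iff₀ hden]
  nlinarith [mul_nonneg hσ0 hσ0]

/-- ★ **PROP. 3 (123) AT `V₀ = 1` IN THE LOGARITHMIC CHART, SINGLE BAR, C⁰**: `‖log Ū(c) − (Q₁Y)(c)‖ ≤ 151·(ℓδ)²` — the potential of the averaged field is the
linearised (0.4) average of the bond variables up to an explicit second-order remainder (print: `Q(V₀, A, c) = L(Q(V₀)A)_c + C(V₀, A, c)`, `|C(V₀, A, c)| ≤ C₁L²|A|²`).
[cite: Balaban1985Averaging, Prop. 3 (121)-(123) p.36; Balaban1987RG1, (0.4) p.253] -/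
theorem norm_mlog_avgFun_sub_linAvg_le (U : GaugeField P j (Matrix.specialUnitaryGroup n ℂ)) {δ : ℝ} (hδ : 0 ≤ δ)
    (hU : ∀ b, ‖((U b : Matrix.specialUnitaryGroup n ℂ) : Matrix n n ℂ) - 1‖ ≤ δ)
    (h24 : 24 * ((((P.d + 2) * P.L : ℕ) : ℝ) * δ) ≤ 1) (hN : 2 * ((((P.d + 2) * P.L : ℕ) : ℝ) * δ) < deltaSU n) (c : PBond P (j + 1)) :
    ‖mlog (((avgFun (expMeanLogSU (n := n)) U c : Matrix.specialUnitaryGroup n ℂ) : Matrix n n ℂ)) -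
        linAvg (fun b => ((U b : Matrix.specialUnitaryGroup n ℂ) : Matrix n n ℂ) - 1) c‖ ≤
      151 * ((((P.d + 2) * P.L : ℕ) : ℝ) * δ) ^ 2 := by
  have h16 : 16 * ((((P.d + 2) * P.L : ℕ) : ℝ) * δ) ≤ 1 := by linarith
  have hR := norm_avgFun_sub_one_sub_linAvg_le U hδ hU h16 hN c
  have hM := norm_mlog_avgFun_sub_sub_one_le U hδ hU h24 hN c
  set W : Matrix n n ℂ := ((avgFun (expMeanLogSU (n := n)) U c : Matrix.specialUnitaryGroup n ℂ) : Matrix n n ℂ)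
  set Q : Matrix n n ℂ := linAvg (fun b => ((U b : Matrix.specialUnitaryGroup n ℂ) : Matrix n n ℂ) - 1) c
  have e : mlog W - Q = (mlog W - (W - 1)) + (W - 1 - Q) := by abel
  rw [e]
  calc _ ≤ _ := norm_add_le _ _
    _ ≤ 70 * ((((P.d + 2) * P.L : ℕ) : ℝ) * δ) ^ 2 + 81 * ((((P.d + 2) * P.L : ℕ) : ℝ) * δ) ^ 2 := add_le_add hM hR
    _ = _ := by ring

end CZero

/-! ## §2 Lipschitz bounds with the smallness factor (C¹) -/

section COne

/-- **THE (0.4) AVERAGE IS LIPSCHITZ, WITH FIRST-ORDER CONSTANT `3ℓ`**: `‖Ū(c) − Ū′(c)‖ ≤ (3 + 181ℓδ)·ℓ·ε` for `SU(N)` configurations within `δ` of `1` and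
within `ε` of each other bondwise (`Ū − Ū′ = Q₁(Y − Y′) + (R_c(U) − R_c(U′))`; `Prop7AvgLinearisation.linAvg_sub ∕ norm_linAvg_le` and module 25).
[cite: Balaban1985Averaging, Prop. 1 p.26 and Prop. 3 (122)-(125) p.36] -/
theorem norm_avgFun_sub_avgFun_le (U U' : GaugeField P j (Matrix.specialUnitaryGroup n ℂ)) {δ ε : ℝ} (hδ : 0 ≤ δ) (hε : 0 ≤ ε)
    (hU : ∀ b, ‖((U b : Matrix.specialUnitaryGroup n ℂ) : Matrix n n ℂ) - 1‖ ≤ δ)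
    (hU' : ∀ b, ‖((U' b : Matrix.specialUnitaryGroup n ℂ) : Matrix n n ℂ) - 1‖ ≤ δ)
    (hUU' : ∀ b, ‖((U b : Matrix.specialUnitaryGroup n ℂ) : Matrix n n ℂ) - ((U' b : Matrix.specialUnitaryGroup n ℂ) : Matrix n n ℂ)‖ ≤ ε)
    (h24 : 24 * ((((P.d + 2) * P.L : ℕ) : ℝ) * δ) ≤ 1) (hN : 2 * ((((P.d + 2) * P.L : ℕ) : ℝ) * δ) < deltaSU n) (c : PBond P (j + 1)) :
    ‖((avgFun (expMeanLogSU (n := n)) U c : Matrix.specialUnitaryGroup n ℂ) : Matrix n n ℂ) -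
        ((avgFun (expMeanLogSU (n := n)) U' c : Matrix.specialUnitaryGroup n ℂ) : Matrix n n ℂ)‖ ≤
      (3 + 181 * ((((P.d + 2) * P.L : ℕ) : ℝ) * δ)) * ((((P.d + 2) * P.L : ℕ) : ℝ) * ε) := by
  have hN' : (((P.d + 2) * P.L : ℕ) : ℝ) * δ < deltaSU n := by
    have : 0 ≤ (((P.d + 2) * P.L : ℕ) : ℝ) * δ := mul_nonneg (Nat.cast_nonneg _) hδ
    linarith
  have hR := norm_avgRem_sub_avgRem_le U U' hδ hε hU hU' hUU' h24 hN' c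
  set W : Matrix n n ℂ := ((avgFun (expMeanLogSU (n := n)) U c : Matrix.specialUnitaryGroup n ℂ) : Matrix n n ℂ)
  set W' : Matrix n n ℂ := ((avgFun (expMeanLogSU (n := n)) U' c : Matrix.specialUnitaryGroup n ℂ) : Matrix n n ℂ)
  set Y : PBond P j → Matrix n n ℂ := fun b => ((U b : Matrix.specialUnitaryGroup n ℂ) : Matrix n n ℂ) - 1 with hY
  set Y' : PBond P j → Matrix n n ℂ := fun b => ((U' b : Matrix.specialUnitaryGroup n ℂ) : Matrix n n ℂ) - 1 with hY'
  have hQ : ‖linAvg Y c - linAvg Y' c‖ ≤ 3 * (((P.d + 2) * P.L : ℕ) : ℝ) * ε := by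
    rw [← linAvg_sub]
    refine norm_linAvg_le _ hε (fun b => ?_) c
    simp only [hY, hY', sub_sub_sub_cancel_right]
    exact hUU' b
  have e : W - W' = ((W - 1 - linAvg Y c) - (W' - 1 - linAvg Y' c)) + (linAvg Y c - linAvg Y' c) := by abel
  rw [e]
  calc _ ≤ _ := norm_add_le _ _
    _ ≤ 181 * ((((P.d + 2) * P.L : ℕ) : ℝ)) ^ 2 * δ * ε + 3 * (((P.d + 2) * P.L : ℕ) : ℝ) * ε := add_le_add hR hQ
    _ = _ := by ring

/-- ★ **PROP. 3 IN THE LOGARITHMIC CHART, SINGLE BAR, C¹: THE POTENTIAL REMAINDER IS LIPSCHITZ WITH THE SMALLNESS FACTOR.**  For `P_c(U) := log Ū(c) − (Q₁Y)(c)`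
and `SU(N)` configurations `U, U′` within `δ` of `1` and within `ε` of each other bondwise (`24ℓδ ≤ 1`, `2ℓδ < δ_N`):
`‖P_c(U) − P_c(U′)‖ ≤ 290·ℓ²·δ·ε` — module 25's `181ℓ²δε` for the exp-free remainder plus the Federbush mean-value defect of `log` on the ball `‖W − 1‖ ≤ 7ℓδ`
(`ρ∕(1−ρ)·‖Ū(c) − Ū′(c)‖`, `‖Ū(c) − Ū′(c)‖ ≤ (3 + 181ℓδ)ℓε`).  Print: «`C(V₀, A, c)` is an analytic function of `A` whose Taylor expansion begins with a second-order
polynomial». [cite: Balaban1985Averaging, Prop. 3 (121)-(123) p.36; Balaban1987RG1, (0.4) and (0.8) p.253] -/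
theorem norm_potRem_sub_potRem_le (U U' : GaugeField P j (Matrix.specialUnitaryGroup n ℂ)) {δ ε : ℝ} (hδ : 0 ≤ δ) (hε : 0 ≤ ε)
    (hU : ∀ b, ‖((U b : Matrix.specialUnitaryGroup n ℂ) : Matrix n n ℂ) - 1‖ ≤ δ)
    (hU' : ∀ b, ‖((U' b : Matrix.specialUnitaryGroup n ℂ) : Matrix n n ℂ) - 1‖ ≤ δ)
    (hUU' : ∀ b, ‖((U b : Matrix.specialUnitaryGroup n ℂ) : Matrix n n ℂ) - ((U' b : Matrix.specialUnitaryGroup n ℂ) : Matrix n n ℂ)‖ ≤ ε)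
    (h24 : 24 * ((((P.d + 2) * P.L : ℕ) : ℝ) * δ) ≤ 1) (hN : 2 * ((((P.d + 2) * P.L : ℕ) : ℝ) * δ) < deltaSU n) (c : PBond P (j + 1)) :
    ‖(mlog (((avgFun (expMeanLogSU (n := n)) U c : Matrix.specialUnitaryGroup n ℂ) : Matrix n n ℂ)) -
          linAvg (fun b => ((U b : Matrix.specialUnitaryGroup n ℂ) : Matrix n n ℂ) - 1) c) -
        (mlog (((avgFun (expMeanLogSU (n := n)) U' c : Matrix.specialUnitaryGroup n ℂ) : Matrix n n ℂ)) -
          linAvg (fun b => ((U' b : Matrix.specialUnitaryGroup n ℂ) : Matrix n n ℂ) - 1) c)‖ ≤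
      290 * ((((P.d + 2) * P.L : ℕ) : ℝ)) ^ 2 * δ * ε := by
  -- letters
  set ℓ : ℝ := (((P.d + 2) * P.L : ℕ) : ℝ) with hℓ
  set σ : ℝ := ℓ * δ with hσ
  have hℓ0 : 0 ≤ ℓ := Nat.cast_nonneg _
  have hσ0 : 0 ≤ σ := mul_nonneg hℓ0 hδ
  have hσ24 : 24 * σ ≤ 1 := h24
  have hN' : ℓ * δ < deltaSU n := by rw [← hσ]; linarith
  set W : Matrix n n ℂ := ((avgFun (expMeanLogSU (n := n)) U c : Matrix.specialUnitaryGroup n ℂ) : Matrix n n ℂ) with hWdef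
  set W' : Matrix n n ℂ := ((avgFun (expMeanLogSU (n := n)) U' c : Matrix.specialUnitaryGroup n ℂ) : Matrix n n ℂ) with hW'def
  set Q : Matrix n n ℂ := linAvg (fun b => ((U b : Matrix.specialUnitaryGroup n ℂ) : Matrix n n ℂ) - 1) c with hQdef
  set Q' : Matrix n n ℂ := linAvg (fun b => ((U' b : Matrix.specialUnitaryGroup n ℂ) : Matrix n n ℂ) - 1) c with hQ'def
  -- the two bricks
  have hR : ‖(W - 1 - Q) - (W' - 1 - Q')‖ ≤ 181 * ℓ ^ 2 * δ * ε := norm_avgRem_sub_avgRem_le U U' hδ hε hU hU' hUU' h24 hN' c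
  have hW1 : ‖W - 1‖ ≤ 7 * σ := norm_avgFun_sub_one_le_lin U hδ hU h24 hN c
  have hW'1 : ‖W' - 1‖ ≤ 7 * σ := norm_avgFun_sub_one_le_lin U' hδ hU' h24 hN c
  have hWW' : ‖W - W'‖ ≤ (3 + 181 * σ) * (ℓ * ε) := norm_avgFun_sub_avgFun_le U U' hδ hε hU hU' hUU' h24 hN c
  have hρ : 7 * σ < 1 := by linarith
  have hlog : ‖mlog W - mlog W' - (W - W')‖ ≤ 7 * σ / (1 - 7 * σ) * ‖W - W'‖ := norm_mlog_sub_mlog_sub_le hρ hW1 hW'1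
  -- the defect factor `7σ∕(1 − 7σ) ≤ 10σ`
  have hden : 0 < 1 - 7 * σ := by linarith
  have hfac : 7 * σ / (1 - 7 * σ) ≤ 10 * σ := by
    rw [div_le_iff₀ hden]; nlinarith
  have hlog' : ‖mlog W - mlog W' - (W - W')‖ ≤ 10 * σ * ((3 + 181 * σ) * (ℓ * ε)) :=
    hlog.trans (mul_le_mul hfac hWW' (norm_nonneg _) (by positivity))
  -- assembly
  have e : (mlog W - Q) - (mlog W' - Q') = (mlog W - mlog W' - (W - W')) + ((W - 1 - Q) - (W' - 1 - Q')) := by abel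
  rw [e]
  have hℓε : 0 ≤ ℓ * ε := mul_nonneg hℓ0 hε
  calc _ ≤ _ := norm_add_le _ _
    _ ≤ 10 * σ * ((3 + 181 * σ) * (ℓ * ε)) + 181 * ℓ ^ 2 * δ * ε := add_le_add hlog' hR
    _ = (211 + 1810 * σ) * σ * (ℓ * ε) := by rw [hσ]; ring
    _ ≤ 290 * σ * (ℓ * ε) := by
        have h1 : (211 + 1810 * σ) ≤ 290 := by linarith
        exact mul_le_mul_of_nonneg_right (mul_le_mul_of_nonneg_right h1 hσ0) hℓε
    _ = 290 * ℓ ^ 2 * δ * ε := by rw [hσ]; ring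

end COne

/-! ## §3 Translation covariance and coarse differences of the potential remainder -/

section CoarseDiff

/-- The potential of the average of a translated configuration is the potential at the translated bond (`BlockAveraging.avgFun_translate`).
[cite: Balaban1987RG1, (2.17) p.269] -/
theorem mlog_avgFun_translate (a : Site P (j + 1)) (U : GaugeField P j (Matrix.specialUnitaryGroup n ℂ)) (c : PBond P (j + 1)) :
    mlog (((avgFun (expMeanLogSU (n := n)) (U.translate (Site.scale a)) c : Matrix.specialUnitaryGroup n ℂ) : Matrix n n ℂ)) =
      mlog (((avgFun (expMeanLogSU (n := n)) U (c.translate a) : Matrix.specialUnitaryGroup n ℂ) : Matrix n n ℂ)) := by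
  rw [avgFun_translate_apply]

/-- **THE POTENTIAL REMAINDER IS TRANSLATION-COVARIANT**: `P_c(U ∘ τ_{La}) = P_{c+a}(U)` (`avgFun_translate` and module 26's `linAvg_translate`).
[cite: Balaban1985Averaging, Prop. 3 (122)-(125) p.36; Balaban1987RG1, (2.17) p.269] -/
theorem potRem_translate (a : Site P (j + 1)) (U : GaugeField P j (Matrix.specialUnitaryGroup n ℂ)) (c : PBond P (j + 1)) :
    mlog (((avgFun (expMeanLogSU (n := n)) (U.translate (Site.scale a)) c : Matrix.specialUnitaryGroup n ℂ) : Matrix n n ℂ)) -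
        linAvg (fun b => (((U.translate (Site.scale a)) b : Matrix.specialUnitaryGroup n ℂ) : Matrix n n ℂ) - 1) c =
      mlog (((avgFun (expMeanLogSU (n := n)) U (c.translate a) : Matrix.specialUnitaryGroup n ℂ) : Matrix n n ℂ)) -
        linAvg (fun b => ((U b : Matrix.specialUnitaryGroup n ℂ) : Matrix n n ℂ) - 1) (c.translate a) := by
  rw [mlog_avgFun_translate]
  simp only [GaugeField.translate_apply]
  rw [YMDAG.N18.HolonomyLipschitz.linAvg_translate a (fun b => ((U b : Matrix.specialUnitaryGroup n ℂ) : Matrix n n ℂ) - 1) c]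

/-- ★ **COARSE DIFFERENCES OF THE POTENTIAL REMAINDER ARE SECOND ORDER**: if every bond variable of `U` is within `δ` of `1` (`24ℓδ ≤ 1`, `2ℓδ < δ_N`) and `U`
differs from its translate by the fine vector `La` by at most `η` bondwise, then `‖P_{c+a}(U) − P_c(U)‖ ≤ 290·ℓ²·δ·η` for every coarse bond `c` — §2 at the pair
`(U ∘ τ_{La}, U)` and `potRem_translate`. [cite: Balaban1985Averaging, Prop. 3 (122)-(125) p.36; Balaban1987RG1, (1.12) p.262 and (2.17) p.269] -/
theorem norm_potRem_translate_sub_le (U : GaugeField P j (Matrix.specialUnitaryGroup n ℂ)) (a : Site P (j + 1)) {δ η : ℝ} (hδ : 0 ≤ δ) (hη : 0 ≤ η)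
    (hU : ∀ b, ‖((U b : Matrix.specialUnitaryGroup n ℂ) : Matrix n n ℂ) - 1‖ ≤ δ)
    (hUa : ∀ b, ‖((U (b.translate (Site.scale a)) : Matrix.specialUnitaryGroup n ℂ) : Matrix n n ℂ) - ((U b : Matrix.specialUnitaryGroup n ℂ) : Matrix n n ℂ)‖ ≤ η)
    (h24 : 24 * ((((P.d + 2) * P.L : ℕ) : ℝ) * δ) ≤ 1) (hN : 2 * ((((P.d + 2) * P.L : ℕ) : ℝ) * δ) < deltaSU n) (c : PBond P (j + 1)) :
    ‖(mlog (((avgFun (expMeanLogSU (n := n)) U (c.translate a) : Matrix.specialUnitaryGroup n ℂ) : Matrix n n ℂ)) -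
          linAvg (fun b => ((U b : Matrix.specialUnitaryGroup n ℂ) : Matrix n n ℂ) - 1) (c.translate a)) -
        (mlog (((avgFun (expMeanLogSU (n := n)) U c : Matrix.specialUnitaryGroup n ℂ) : Matrix n n ℂ)) -
          linAvg (fun b => ((U b : Matrix.specialUnitaryGroup n ℂ) : Matrix n n ℂ) - 1) c)‖ ≤
      290 * ((((P.d + 2) * P.L : ℕ) : ℝ)) ^ 2 * δ * η := by
  rw [← potRem_translate a U c]
  exact norm_potRem_sub_potRem_le (U.translate (Site.scale a)) U hδ hη (fun b => by rw [GaugeField.translate_apply]; exact hU _) hU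
    (fun b => by rw [GaugeField.translate_apply]; exact hUa b) h24 hN c

/-- `scale e_ν = L • e_ν` one level down (public twin `B13AvgCorrKappaOneLetters.scale_zero_shift` in the `Support` tree of the T⁴ programme, not imported; kept private). [folklore] -/
private theorem scale_zero_shift (ν : Fin P.d) : Site.scale ((0 : Site P (j + 1)).shift ν) = P.L • (0 : Site P j).shift ν := by
  funext κ
  show Site.scaleCoord P j (((0 : Site P (j + 1)).shift ν) κ) = P.L • (((0 : Site P j).shift ν) κ)
  by_cases h : κ = ν
  · have h1 : ((0 : Site P (j + 1)).shift ν) κ = 1 := by rw [Site.shift_apply, if_pos h, Site.zero_apply, zero_add]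
    have h2 : ((0 : Site P j).shift ν) κ = 1 := by rw [Site.shift_apply, if_pos h, Site.zero_apply, zero_add]
    rw [h1, h2, Site.scaleCoord_one, nsmul_eq_mul, mul_one]
  · have h1 : ((0 : Site P (j + 1)).shift ν) κ = 0 := by rw [Site.shift_apply, if_neg h, Site.zero_apply]
    have h2 : ((0 : Site P j).shift ν) κ = 0 := by rw [Site.shift_apply, if_neg h, Site.zero_apply]
    rw [h1, h2, map_zero, smul_zero]

omit [Fintype n] [DecidableEq n] [Nonempty n] in
/-- Translating a bond by the unit vector `e_ν` shifts its source (`Site.add_zero_shift`). [folklore] -/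
private theorem translate_zero_shift {i : ℕ} (b : PBond P i) (ν : Fin P.d) : b.translate ((0 : Site P i).shift ν) = ⟨b.src.shift ν, b.dir⟩ := by
  cases b; simp only [PBond.translate, Site.add_zero_shift]

/-- **COARSE UNIT DIFFERENCES OF THE POTENTIAL REMAINDER**: with `δ₁` a bound on the fine unit `ν`-differences `‖U(b + e_ν) − U(b)‖` of the configuration,
`‖P_{⟨y + e_ν, μ⟩}(U) − P_{⟨y, μ⟩}(U)‖ ≤ 290·ℓ²·δ·(L·δ₁)` — the coarse step `e_ν` is the fine translation by `L·e_ν` (`Site.scale`), telescoped by module 26's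
`norm_translate_nsmul_sub_le`.  The coarse difference quotient of the remainder carries the factor `δ` of the ball: second order.
[cite: Balaban1987RG1, (1.12) p.262; Balaban1985Averaging, Prop. 3 (122)-(125) p.36] -/
theorem norm_potRem_shift_sub_le (U : GaugeField P j (Matrix.specialUnitaryGroup n ℂ)) (y : Site P (j + 1)) (μ ν : Fin P.d) {δ δ₁ : ℝ} (hδ : 0 ≤ δ)
    (hδ₁ : 0 ≤ δ₁) (hU : ∀ b, ‖((U b : Matrix.specialUnitaryGroup n ℂ) : Matrix n n ℂ) - 1‖ ≤ δ)
    (hU₁ : ∀ b : PBond P j, ‖((U ⟨b.src.shift ν, b.dir⟩ : Matrix.specialUnitaryGroup n ℂ) : Matrix n n ℂ) - ((U b : Matrix.specialUnitaryGroup n ℂ) : Matrix n n ℂ)‖ ≤ δ₁)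
    (h24 : 24 * ((((P.d + 2) * P.L : ℕ) : ℝ) * δ) ≤ 1) (hN : 2 * ((((P.d + 2) * P.L : ℕ) : ℝ) * δ) < deltaSU n) :
    ‖(mlog (((avgFun (expMeanLogSU (n := n)) U ⟨y.shift ν, μ⟩ : Matrix.specialUnitaryGroup n ℂ) : Matrix n n ℂ)) -
          linAvg (fun b => ((U b : Matrix.specialUnitaryGroup n ℂ) : Matrix n n ℂ) - 1) ⟨y.shift ν, μ⟩) -
        (mlog (((avgFun (expMeanLogSU (n := n)) U ⟨y, μ⟩ : Matrix.specialUnitaryGroup n ℂ) : Matrix n n ℂ)) -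
          linAvg (fun b => ((U b : Matrix.specialUnitaryGroup n ℂ) : Matrix n n ℂ) - 1) ⟨y, μ⟩)‖ ≤
      290 * ((((P.d + 2) * P.L : ℕ) : ℝ)) ^ 2 * δ * (P.L * δ₁) := by
  have hc : (⟨y.shift ν, μ⟩ : PBond P (j + 1)) = (⟨y, μ⟩ : PBond P (j + 1)).translate ((0 : Site P (j + 1)).shift ν) := by
    rw [translate_zero_shift]
  rw [hc]
  refine norm_potRem_translate_sub_le U _ hδ (mul_nonneg (Nat.cast_nonneg _) hδ₁) hU (fun b => ?_) h24 hN _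
  rw [scale_zero_shift]
  have h := norm_translate_nsmul_sub_le U ((0 : Site P j).shift ν) hδ₁ (fun b' => by rw [translate_zero_shift]; exact hU₁ b') P.L b
  exact h

end CoarseDiff

/-! ## §4 The letters of the comb-corrected averaged potential from King's K-row -/

section Letters

/-- ★ **THE AVERAGED POTENTIAL, MAIN TERM IDENTIFIED**: `log Ū(c) + (λ̄_Y(c₊) − λ̄_Y(c₋)) = L·(QY)(c) + P_c(U)` with `Q = LatticeFieldCalculus.bondAvg` the straight block
average OF RECORD, `λ̄_Y = combMean Y` the block comb means (the linearised coarse gauge `v` of (62)) and `P_c(U) = log Ū(c) − (Q₁Y)(c)` the second-order potential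
remainder of §1–§3 (`linAvg_eq_bondAvg_sub_grad_combMean`). [cite: Balaban1985Averaging, (62) p.28 and (124)-(125) p.36] -/
theorem mlog_avgFun_add_grad_combMean_eq (U : GaugeField P j (Matrix.specialUnitaryGroup n ℂ)) (c : PBond P (j + 1)) :
    mlog (((avgFun (expMeanLogSU (n := n)) U c : Matrix.specialUnitaryGroup n ℂ) : Matrix n n ℂ)) +
        (combMean (fun b => ((U b : Matrix.specialUnitaryGroup n ℂ) : Matrix n n ℂ) - 1) c.tgt -
          combMean (fun b => ((U b : Matrix.specialUnitaryGroup n ℂ) : Matrix n n ℂ) - 1) c.src) =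
      ((P.L : ℕ) : ℂ) • bondAvg (fun b => ((U b : Matrix.specialUnitaryGroup n ℂ) : Matrix n n ℂ) - 1) c +
        (mlog (((avgFun (expMeanLogSU (n := n)) U c : Matrix.specialUnitaryGroup n ℂ) : Matrix n n ℂ)) -
          linAvg (fun b => ((U b : Matrix.specialUnitaryGroup n ℂ) : Matrix n n ℂ) - 1) c) := by
  rw [linAvg_eq_bondAvg_sub_grad_combMean]
  abel

/-- ★ **THE SUP LETTER** of the comb-corrected averaged potential: if the bond variables `Y = U − 1` are bounded by `a` on the `L^{d+1}` FEEDING bonds of `c`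
(`runBond (blockSite c₋ r) (dir c) t`, `t < L` — dag-n18-d (K-a) LOCAL) and by `δ` everywhere (`24ℓδ ≤ 1`, `2ℓδ < δ_N`), then
`‖log Ū(c) + (λ̄_Y(c₊) − λ̄_Y(c₋))‖ ≤ L·a + 151(ℓδ)²` — King's `‖Q‖_{∞→∞} ≤ 1` times the factor `L` of the main term, plus the second-order remainder; in the chart
`U = exp(iξA)`, `a ≈ ξ·|A|_□`, this is print's `|Ā| ≤ |A|_□·(1 + O(ℓ²ξα₀))` before the comb gauge. [cite: Balaban1987RG1, (1.12) p.262; Balaban1985Averaging, Prop. 3 (123) p.36] -/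
theorem norm_mlog_avgFun_add_grad_combMean_le (U : GaugeField P j (Matrix.specialUnitaryGroup n ℂ)) (c : PBond P (j + 1)) {δ a : ℝ} (hδ : 0 ≤ δ)
    (hU : ∀ b, ‖((U b : Matrix.specialUnitaryGroup n ℂ) : Matrix n n ℂ) - 1‖ ≤ δ)
    (ha : ∀ r : Fin P.d → Fin P.L, ∀ t < P.L, ‖((U (runBond (Site.blockSite c.src r) c.dir t) : Matrix.specialUnitaryGroup n ℂ) : Matrix n n ℂ) - 1‖ ≤ a)
    (h24 : 24 * ((((P.d + 2) * P.L : ℕ) : ℝ) * δ) ≤ 1) (hN : 2 * ((((P.d + 2) * P.L : ℕ) : ℝ) * δ) < deltaSU n) :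
    ‖mlog (((avgFun (expMeanLogSU (n := n)) U c : Matrix.specialUnitaryGroup n ℂ) : Matrix n n ℂ)) +
        (combMean (fun b => ((U b : Matrix.specialUnitaryGroup n ℂ) : Matrix n n ℂ) - 1) c.tgt -
          combMean (fun b => ((U b : Matrix.specialUnitaryGroup n ℂ) : Matrix n n ℂ) - 1) c.src)‖ ≤
      P.L * a + 151 * ((((P.d + 2) * P.L : ℕ) : ℝ) * δ) ^ 2 := by
  rw [mlog_avgFun_add_grad_combMean_eq]
  have hQ : ‖bondAvg (fun b => ((U b : Matrix.specialUnitaryGroup n ℂ) : Matrix n n ℂ) - 1) c‖ ≤ a :=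
    norm_bondAvg_le_of_forall_run (V := Matrix n n ℂ) _ c ha
  have hP := norm_mlog_avgFun_sub_linAvg_le U hδ hU h24 hN c
  have hL : ‖((P.L : ℕ) : ℂ) • bondAvg (fun b => ((U b : Matrix.specialUnitaryGroup n ℂ) : Matrix n n ℂ) - 1) c‖ ≤ P.L * a := by
    rw [norm_smul, Complex.norm_natCast]
    exact mul_le_mul_of_nonneg_left hQ (Nat.cast_nonneg _)
  exact (norm_add_le _ _).trans (add_le_add hL hP)

/-- ★ **THE COARSE-DIFFERENCE LETTER** of the comb-corrected averaged potential (standing range `j + 1 ≤ m + K`): with `δ₁` a bound on the fine unit `ν`-differences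
`‖U(b + e_ν) − U(b)‖` of the configuration (so of `Y = U − 1`) and `δ` the radius of the ball (`24ℓδ ≤ 1`, `2ℓδ < δ_N`), for `c = ⟨y, μ⟩` and `c′ = ⟨y + e_ν, μ⟩`:
`‖[log Ū + dλ̄_Y](c′) − [log Ū + dλ̄_Y](c)‖ ≤ L·(L·δ₁) + 290·ℓ²·δ·(L·δ₁)` — `L ×` King's (K-b) (`norm_bondAvg_shift_sub_le_of_forall_run`: ONE telescoping per straight
contour, `≤ L·δ₁`) plus the coarse unit difference of the remainder (§3): the second term carries the extra factor `290ℓ²δ = O(d²L·ℓδ)` — in the chart `U = exp(iξA)` the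
relative slack `O(d²L·ξ|A|)` of the spec's (β2)–(β5), summable in the scale. [cite: Balaban1987RG1, (1.12) p.262; Balaban1985Averaging, Prop. 3 (123) p.36] -/
theorem norm_shift_sub_mlog_avgFun_add_grad_combMean_le (hj : j + 1 ≤ P.m + P.K) (U : GaugeField P j (Matrix.specialUnitaryGroup n ℂ)) (y : Site P (j + 1))
    (μ ν : Fin P.d) {δ δ₁ : ℝ} (hδ : 0 ≤ δ) (hδ₁ : 0 ≤ δ₁)
    (hU : ∀ b, ‖((U b : Matrix.specialUnitaryGroup n ℂ) : Matrix n n ℂ) - 1‖ ≤ δ)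
    (hU₁ : ∀ b : PBond P j, ‖((U ⟨b.src.shift ν, b.dir⟩ : Matrix.specialUnitaryGroup n ℂ) : Matrix n n ℂ) - ((U b : Matrix.specialUnitaryGroup n ℂ) : Matrix n n ℂ)‖ ≤ δ₁)
    (h24 : 24 * ((((P.d + 2) * P.L : ℕ) : ℝ) * δ) ≤ 1) (hN : 2 * ((((P.d + 2) * P.L : ℕ) : ℝ) * δ) < deltaSU n) :
    ‖(mlog (((avgFun (expMeanLogSU (n := n)) U ⟨y.shift ν, μ⟩ : Matrix.specialUnitaryGroup n ℂ) : Matrix n n ℂ)) +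
          (combMean (fun b => ((U b : Matrix.specialUnitaryGroup n ℂ) : Matrix n n ℂ) - 1) (⟨y.shift ν, μ⟩ : PBond P (j + 1)).tgt -
            combMean (fun b => ((U b : Matrix.specialUnitaryGroup n ℂ) : Matrix n n ℂ) - 1) (y.shift ν))) -
        (mlog (((avgFun (expMeanLogSU (n := n)) U ⟨y, μ⟩ : Matrix.specialUnitaryGroup n ℂ) : Matrix n n ℂ)) +
          (combMean (fun b => ((U b : Matrix.specialUnitaryGroup n ℂ) : Matrix n n ℂ) - 1) (⟨y, μ⟩ : PBond P (j + 1)).tgt -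
            combMean (fun b => ((U b : Matrix.specialUnitaryGroup n ℂ) : Matrix n n ℂ) - 1) y))‖ ≤
      P.L * (P.L * δ₁) + 290 * ((((P.d + 2) * P.L : ℕ) : ℝ)) ^ 2 * δ * (P.L * δ₁) := by
  have e1 := mlog_avgFun_add_grad_combMean_eq U (⟨y.shift ν, μ⟩ : PBond P (j + 1))
  have e0 := mlog_avgFun_add_grad_combMean_eq U (⟨y, μ⟩ : PBond P (j + 1))
  rw [show (⟨y.shift ν, μ⟩ : PBond P (j + 1)).src = y.shift ν from rfl] at e1
  rw [show (⟨y, μ⟩ : PBond P (j + 1)).src = y from rfl] at e0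
  rw [e1, e0]
  set Y : PBond P j → Matrix n n ℂ := fun b => ((U b : Matrix.specialUnitaryGroup n ℂ) : Matrix n n ℂ) - 1 with hY
  -- King's (K-b), local form, fed by the global unit differences
  have hKb : ‖bondAvg Y ⟨y.shift ν, μ⟩ - bondAvg Y ⟨y, μ⟩‖ ≤ P.L * δ₁ := by
    refine norm_bondAvg_shift_sub_le_of_forall_run (V := Matrix n n ℂ) hj Y y μ ν fun r t _ s _ => ?_
    have h := hU₁ ⟨runSite (runSite (Site.blockSite y r) μ t) ν s, μ⟩
    simp only [hY, sub_sub_sub_cancel_right]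
    exact h
  have hP := norm_potRem_shift_sub_le U y μ ν hδ hδ₁ hU hU₁ h24 hN
  have e : ((P.L : ℕ) : ℂ) • bondAvg Y ⟨y.shift ν, μ⟩ +
        (mlog (((avgFun (expMeanLogSU (n := n)) U ⟨y.shift ν, μ⟩ : Matrix.specialUnitaryGroup n ℂ) : Matrix n n ℂ)) - linAvg Y ⟨y.shift ν, μ⟩) -
      (((P.L : ℕ) : ℂ) • bondAvg Y ⟨y, μ⟩ +
        (mlog (((avgFun (expMeanLogSU (n := n)) U ⟨y, μ⟩ : Matrix.specialUnitaryGroup n ℂ) : Matrix n n ℂ)) - linAvg Y ⟨y, μ⟩)) =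
      ((P.L : ℕ) : ℂ) • (bondAvg Y ⟨y.shift ν, μ⟩ - bondAvg Y ⟨y, μ⟩) +
        ((mlog (((avgFun (expMeanLogSU (n := n)) U ⟨y.shift ν, μ⟩ : Matrix.specialUnitaryGroup n ℂ) : Matrix n n ℂ)) - linAvg Y ⟨y.shift ν, μ⟩) -
          (mlog (((avgFun (expMeanLogSU (n := n)) U ⟨y, μ⟩ : Matrix.specialUnitaryGroup n ℂ) : Matrix n n ℂ)) - linAvg Y ⟨y, μ⟩)) := by
    rw [smul_sub]; abel
  rw [e]
  have hL : ‖((P.L : ℕ) : ℂ) • (bondAvg Y ⟨y.shift ν, μ⟩ - bondAvg Y ⟨y, μ⟩)‖ ≤ P.L * (P.L * δ₁) := by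
    rw [norm_smul, Complex.norm_natCast]
    exact mul_le_mul_of_nonneg_left hKb (Nat.cast_nonneg _)
  exact (norm_add_le _ _).trans (add_le_add hL hP)

end Letters

end YMDAG.N18.AvgPotential
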